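import Mathlib
import Literature.MathematicalPhysics.QuantumFieldTheory.Balaban1983to89.B13Contraction113
import Literature.MathematicalPhysics.QuantumFieldTheory.Balaban1983to89.B8SectDSource
import Literature.MathematicalPhysics.QuantumFieldTheory.Balaban1983to89.B11

/-! # `Balaban1983to89.B11Prop6Scheme` — the contraction scheme (116)–(121) behind Proposition 6 of
[Balaban1985Variational], with the 𝔊J term, and its transfer to Eq. (143) («Proposition 6 is valid for it also»)
and to Eq. (158), kernel-checked over abstract complex Banach spaces

CITATION HEADER (lean-in-tree rule 2026-08-18).  T. Bałaban, *The variational problem and background fields in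
renormalization group method for lattice gauge theories*, Commun. Math. Phys. **102**, 277–309 (1985)
[Balaban1985Variational] (cell paper B11; held `paper:balaban1985-cmp102-variational-background`, journal page = PDF
page + 276): Sect. E pp. 294–296 [PDF 18–20], displays (115)–(121) and Proposition 6; p. 300 [PDF 24], display (143)
and the paragraph after it; p. 302 [PDF 26], display (158) and the two sentences after it; p. 306 [PDF 30], the
display before (180).  Renders `b2b-balaban-ref1/pages/1985-cmp102-variational-background/1985-cmp102-variational-
background-p019-x2.png` (p. 295) and `…-p024-x2.png` (p. 300) READ AS IMAGES by this seat 2026-08-19; pp. 296, 302,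
306 quoted from the lineage transcript `b2b-balaban-b11/transcript.md` (render-checked by gens 1–4 of this lineage,
p. 302 marked «render re-checked»).  The paper is UNDER ADJUDICATION by the audit cell `pub-balaban`: NOTHING printed
in it is asserted here.  Every analytic input of the printed argument — the norm bound «By Theorem 3.13 of [5]» of the
propagator 𝔊 (constant B₀), the quadratic bound (98) and the analyticity of (δ/δA′)V of Proposition 4 (constants C₄,
a₃), the bounds |J|_{(−3)} < C₁B₃ε₁ and |B| < 2dLC₁ε₁, |H₁B| ≤ B₀|B|, and for (143) the norm of G̃ = GP₀* and the
smallness of G̃Δ^{(2)} — enters as a HYPOTHESIS over abstract complex normed spaces; what is proved is proved by the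
kernel from Mathlib and from three ACCEPTED sibling modules used BY NAME: `B13Contraction113` (unit b2b-balaban-b13-g5:
the hypothesis structure `QuadAnalytic`, the Cauchy step `norm_sub_le_of_sphere_bound`, the analytic-dependence
theorem `differentiableOn_fixedPoint`), `B8SectDSource` (unit pv17 lineage: Banach's theorem on a closed ball
`fixedPoint_closedBall`, `fixedPoint_mem_of_invariant`) and `B11` (this lineage: the real arithmetic `ineq118_121` of
(118), (121)).  NEW sibling module; imports only the three modules named and Mathlib; modifies nothing.  Unit
`b2b-balaban-b11-g10` (planner seat, PAPER SUB-CELL B11 gen 10); cell records: GAPS G-B11-E7 (the objection «by-analogy»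
this file answers in the kernel), C-adv7-12 (the referee's prose certificate of the same sentence, adv7-g5, whose
items (a), (c), (e) are kernel-checked here), C-B11-E1 and C-adv7-1 (the arithmetic of (116)–(122), a₄ = min{a₃⁄4,
(16B₀C₄)⁻¹}), C-B11-E7K (this certificate), DIVERGENCE D-B11-20 (modelling conventions below); statement-level typing
of Proposition 6 itself: `B11.Prop6Printed` (unchanged, not imported into any proof here).

WHAT IS PRINTED.  p. 295 [PDF 19] (render read as image): *«We will prove that for ε₄ sufficiently small the equation
has a unique solution, and the solution is in the space (115) with ε₄ = O(ε₁). A solution of Eq. (111) is a fixed point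
of the transformation A₁ → −𝔊J − 𝔊((δ/δA′)V)(A₁ + H₁B). (116) At first let us investigate for which ε₄ this
transformation maps the space (115) into itself. By Theorem 3.13 of [5] the norm max{|·|_{(−1)}, |∇·|_{(−2)}} of the
transformation can be estimated by B₀|J|_{(−3)} + B₀|((δ/δA′)V)(A₁ + H₁B)|_{(−3)} < B₀C₁B₃ε₁ + B₀C₄(ε₄ + B₀|B|)²,
(117) if ε₄ + B₀|B| ≤ a₃. Further, we have the bound |B| < 2dLC₁ε₁; hence the transformation (116) transforms the
space (115) into itself if ε₄ + 2dLB₀C₁ε₁ ≤ a₃, B₀C₁B₃ε₁ + B₀C₄(ε₄ + 2dLB₀C₁ε₁)² ≤ ε₄. (118) These conditions are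
satisfied if e.g. 2B₀C₁B₃ε₁ ≤ ε₄ and ε₄ ≤ a₄ for a sufficiently small a₄. Next, let us investigate when the
transformation (116) is contractive. A difference of its values at configurations A₁, A₂ can be written as
−𝔊∫₀¹dt (d/dt)((δ/δA′)V)((1 − t)A₁ + tA₂ + H₁B) = −𝔊∫₀¹dt (1/2πi)∫_{|τ|=r} dτ τ⁻²((δ/δA′)V)((1 − t)A₁ + tA₂ +
τ(A₁ − A₂) + H₁B). (119) The norm max{|·|_{(−1)}, |∇·|_{(−2)}} of this expression can be estimated by (B₀/r)
sup_{0≤t≤1} sup_{|τ|=r} |((δ/δA′)V)((1 − t)A₁ + tA₂ + τ(A₁ − A₂) + H₁B)|_{(−3)} ≤ (B₀/r)C₄(ε₄ + r max{|A₁ −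
A₂|_{(−1)}, |∇(A₁ − A₂)|_{(−2)}} + B₀|B|)² = 4B₀C₄(ε₄ + B₀|B|)max{|A₁ − A₂|_{(−1)}, |∇(A₁ − A₂)|_{(−2)}}, (120) where
we have taken r = (ε₄ + B₀|B|)(max{|A₁ − A₂|_{(−1)}, |∇(A₁ − A₂)|_{(−2)}})⁻¹. We have to assume also that 2(ε₄ +
B₀|B|) ≤ a₃, in order to be able to apply Proposition 4. Thus the transformation is contractive if 2ε₄ + 4dLB₀C₁ε₁ ≤
a₃, 4B₀C₄(ε₄ + 2dLB₀C₁ε₁) ≤ ½. (121) Assuming 2B₀C₁B₃ε₁ ≤ ε₄, the above conditions are satisfied if ε₄ ≤ a₄, where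
a₄ is a sufficiently small, absolute constant. Thus we have proved the following Proposition 6. There exists a
positive, absolute constant a₄ such, that for ε₄ ≤ a₄ and ε₁ satisfying 2B₀C₁B₃ε₁ ≤ ε₄ Eq. (111) has exactly one
solution in the space (115). This solution satisfies the bounds (115) with ε₄ = 3B₀C₁B₃ε₁. Moreover, if we replace the
configuration H₁B by an arbitrary configuration 𝔄 with values in the complexified Lie»* — p. 296 [PDF 20]: *«algebra,
and satisfying the same bounds as H₁B, then the above statement is again true and the solution is an analytic function
of 𝔄.»*, and the comment *«Only the last statement requires an additional comment. The first part of it is obvious,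
and the analyticity follows from the fact that the solution can be constructed as a uniform limit of a sequence of
successive approximations. The analyticity of these approximations follows from the analyticity of δ/δA′V(A′) as a
function of A′.»*; the space (115) is *«|A₁| < ε₄(L^jη)^{-1}, |∇A₁| < ε₄(L^jη)^{-2} on Ω_j, i.e. max{|A₁|_{(−1)},
|∇A₁|_{(−2)}} < ε₄. (115)»*.  p. 300 [PDF 24] (render read as image): *«hence the above equation can be written as A₀ =
−G̃J + G̃Δ^{(2)}(A₀ + H₀B) − G̃((δ/δA′)V)(A₀ + H₀B). (143) This equation has all the properties of Eq. (111) and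
Proposition 6 is valid for it also. In fact it has better regularity properties, which we have used in the proof of
Proposition 7. However it cannot replace Eq. (111), for example it does not imply necessarily that solutions satisfy
the Landau gauge condition, which was used in the derivation of (143). Thus we have to use both equations, (111) for
proving the existence, and (143) for regularity properties. In the future we will use more frequently Eq. (143).»*
p. 302 [PDF 26]: *«we obtain Eq. (143) for A₁. In the considered case it can be written as A₁ + G̃((δ/δA′)V)(A₁ +
HB) = 0. (158) The configurations HB and A₁ satisfy (152) with the bounds 4dL²B₁Mε₀ and 40dL²B₁Mε₀ correspondingly.
The image of U′_k translated by −HB satisfies Eq. (158). We assume that it belongs to the domain on which this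
equation has a unique solution, i.e. we assume that 40dL²B₁Mε₀ ≤ a₄.»*  p. 306 [PDF 30]: *«where 𝒜₀ satisfies the
equation obtained from (143), 𝒜₀ − G̃Δ^{(2)}(𝒜₀ + H₀B) + G̃((δ/δA′)V)(𝒜₀ + H₀B) = 0. We may simplify this equation
including the operator −Δ^{(2)} into the definition of G, i.e. defining G = (Δ_a − Δ^{(2)})^{-1}. From the estimate
(3.137) it follows that Δ^{(2)} is a small perturbation of Δ_a»*.

WHAT IS PROVED HERE (kernel-checked, complete proofs).  One transformation covers all four printed equations:
`mapT 𝒢 Λ W J 𝔄 X = −𝒢 J + Λ (X + 𝔄) − 𝒢 (W (X + 𝔄))` on abstract complex normed spaces 𝒴 (configurations A₁ with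
the norm of (115)) and 𝒵 (the |·|_{(−3)}-normed currents), 𝒢 : 𝒵 →L[ℂ] 𝒴 with ‖𝒢f‖ ≤ B₀‖f‖ (P2 of C-adv7-12: the
Thm 3.13 [5] norm), Λ : 𝒴 →L[ℂ] 𝒴 with ‖ΛY‖ ≤ θ‖Y‖ (Λ = 0 for (116), (158), (180); Λ = G̃Δ^{(2)} for (143) and the
p. 306 display), W = (δ/δA′)V with `QuadAnalytic W C₄ a₃` (P4: (98) + analyticity along complex lines, B13's
hypothesis structure; the Fréchet form `Prop4Hyp` for the analyticity clause), ‖J‖ ≤ j, ‖𝔄‖ < a (P3: 𝔄 = H₁B with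
a = B₀·2dLC₁ε₁, or the printed «arbitrary configuration 𝔄 … satisfying the same bounds»).
 §1 `bound_117` — the estimate (117) with the θ-term: ‖TX‖ ≤ B₀‖J‖ + θ‖X + 𝔄‖ + B₀C₄‖X + 𝔄‖² if ‖X + 𝔄‖ < a₃;
    `mapsTo_118` — (118) [θ-extended: B₀j + θ(ε₄ + a) + B₀C₄(ε₄ + a)² ≤ ε₄, ε₄ + a ≤ a₃] ⟹ T maps the ball ‖X‖ ≤ ε₄
    into itself; `lipschitz_120` — (119)–(120) LITERALLY: the Cauchy formula on the circles |τ| = r around the segment,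
    r = (ε₄ + a)‖A₁ − A₂‖⁻¹, Prop. 4 applicable because the argument has norm < 2(ε₄ + a) ≤ a₃ ((121), first member),
    giving the Lipschitz constant θ + 4B₀C₄(ε₄ + a) ((120) for θ = 0); `existsUnique_solution` — Banach on the
    closed ball under θ + 4B₀C₄(ε₄ + a) < 1 ((121), second member, asks ≤ ½): EXACTLY ONE solution with ‖X‖ ≤ ε₄;
    `norm_solution_le` — the nested-balls argument behind «This solution satisfies the bounds (115) with ε₄ =
    3B₀C₁B₃ε₁» (existence in every smaller admissible ball + uniqueness in the larger); `solution_mem_of_invariant`,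
    `solution_mem_submodule` — the solution lies in every closed T-invariant set containing 0, in particular in a
    closed subspace containing the ranges of 𝒢 and Λ (P1 of C-adv7-12: «Q𝔊 = 0, RD*𝔊 = 0», so the constraints of
    (115) / of {QA₀ = 0} for (143) hold for the solution automatically; also: real data ⟹ real solution).
 §2 `prop6_solution`, `prop6_bound_printed` — PROPOSITION 6 as printed, first two clauses, θ = 0: under 2B₀C₁B₃ε₁ ≤
    ε₄, 4ε₄ ≤ a₃, 16B₀C₄ε₄ ≤ 1 (i.e. ε₄ ≤ a₄ := min{a₃⁄4, (16B₀C₄)⁻¹}, `le_a4_iff`; C-B11-E1, C-adv7-1) and dL ≤ B₃,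
    with ‖J‖ ≤ C₁B₃ε₁ and ‖𝔄‖ < 2dLB₀C₁ε₁, the printed conditions (118), (121) hold (`B11.ineq118_121`), (116) has
    exactly one fixed point in ‖X‖ ≤ ε₄, and it satisfies ‖X‖ ≤ 2B₀C₁B₃ε₁ (< 3B₀C₁B₃ε₁, the printed constant, as soon
    as B₀C₁B₃ε₁ > 0).
 §3 `conditions_143`, `eq143_solution` — G-B11-E7, the sentence «Proposition 6 is valid for it also» for (143) AS
    PRINTED (with the linear term; the p. 306 display is the same map with J = 0): under Prop. 6's OWN hypotheses
    (same a₄) and the ONE located extra condition 8θ ≤ 1 on θ = ‖G̃Δ^{(2)}‖ (max-norm → max-norm), the θ-extended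
    (118) holds and the contraction constant is ≤ 5⁄8; hence exactly one solution in ‖X‖ ≤ ε₄, with the same bound
    2B₀C₁B₃ε₁.  (C-adv7-12 (e) reads the absorption as «a₄ ↦ a₄⁄2 and ε₄ ≥ 3B₀C₁B₃ε₁» using θ ≤ O(1)B₀C₁B₃ε₁; the
    kernel statement keeps θ abstract: any θ ≤ 1⁄8 works with a₄ unchanged, and θ = O(B₀C₁B₃ε₁) ≤ 1⁄8 is one more
    absolute smallness condition on ε₁ of the kind the paper gathers — in print supported by p. 306 «From the estimate
    (3.137) it follows that Δ^{(2)} is a small perturbation of Δ_a».)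
 §4 `eq158_solution` — (158) p. 302 (J = 0, Λ = 0, background 1): with ‖HB‖ < a ≤ ε₄ (printed a = 4dL²B₁Mε₀ = ε₄⁄10,
    ε₄ = 40dL²B₁Mε₀), 4ε₄ ≤ a₃ and 16B₀C₄ε₄ ≤ 1 (= «40dL²B₁Mε₀ ≤ a₄» with Prop. 6's own a₄; C-adv7-12 (c)) the
    equation has exactly one solution in ‖X‖ ≤ ε₄.
 §5 `Prop4Hyp`, `solution_analytic`, `solution_analytic_line` — the last clause «the solution is an analytic function
    of 𝔄» and p. 296's successive-approximation argument (P5), via `B13Contraction113.differentiableOn_fixedPoint`: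
    for holomorphic families σ ↦ (J_σ, 𝔄_σ) on an open V ⊆ ℂ with ‖J_σ‖ ≤ j, ‖𝔄_σ‖ < a, the solution map σ ↦ X(σ)
    is holomorphic on V (in particular along every complex line 𝔄₀ + σ𝔄₁ inside ‖𝔄‖ < a); this also covers the
    analyticity in B claimed for (180) p. 306 («it has the same analyticity properties»), J_σ and 𝔄_σ = H₀B_σ linear.

NOT CERTIFIED HERE (hypotheses, by name; cell rows in brackets).  (P2) ‖𝔊f‖ ≤ B₀|f|_{(−3)} in the norm of (115) —
[5] = B9 Thm 3.13 for the Sect. D propagator 𝔊 = G₁𝔓* (GAPS C-B11-D1R, C-adv7-8; B9 rows G-B9-15R, G-adv8-3), and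
for (143) the corresponding norm of G̃ = GP₀*, G = Δ_a⁻¹ ([5] Thm 3.3 + the projection P₀, G-B11-E4R / G-IF-02R), for
(158) the U = 1 operators of [2,3] (C-adv7-12 (b)); (P4) Proposition 4 (97)–(98) and the analyticity of (δ/δA′)V for
complex arguments (G-B11-C1 upstream; Prop. 4 itself is B11's own statement, typed `B11.Prop4Printed`, not proved); the
bounds |J|_{(−3)} < C₁B₃ε₁, |B| < 2dLC₁ε₁ ((75)) and max{|H₁B|_{(−1)}, |∇H₁B|_{(−2)}} < B₀2dLC₁ε₁ ((103)); the
smallness θ = ‖G̃Δ^{(2)}‖ ≤ 1⁄8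
((3.137) [5]-type, cf. `B6RandomWalkHom.b11_newG_entry1_of_3137` of pv21 for the Neumann side; G-B11-G1 /
C-adv7-11); the identification of Prop. 6's «space (115)» (an OPEN ball in the constraint space) with the closed ball
of the abstract space (D-B11-20: existence is proved in the closed ball of every admissible radius, so the solution
has norm ≤ 2B₀C₁B₃ε₁ < ε₄ whenever 2B₀C₁B₃ε₁ < ε₄, and uniqueness in the closed ball is stronger than in the open
one); joint analyticity in several parameters (one complex parameter at a time is typed, as in B13Contraction113).
MODELLING CONVENTIONS (DIVERGENCE D-B11-20): one abstract norm ‖·‖ on 𝒴 stands for max{|·|_{(−1)}, |∇·|_{(−2)}} and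
one on 𝒵 for |·|_{(−3)}; 𝔊, G̃, G̃Δ^{(2)} are continuous ℂ-linear maps with the displayed norm bounds as hypotheses
(B₀, θ need not be operator norms); the constraint space is any closed subspace containing the ranges (§1); «analytic»
= `DifferentiableOn ℂ` on the open ball ‖Y‖ < a₃ (Fréchet; on the finite lattice T_η this is the printed analyticity)
for §5 and along complex lines (B13's `QuadAnalytic.lineAnalytic`) for §§1–4; (98) is used with strict ‖Y‖ < a₃ as in
B13Contraction113 (the printed «(98) … valid if … ≤ a₃» is used only for arguments of norm < a₃; every argument
occurring here has norm < 2(ε₄ + a) ≤ a₃).  value = kernel bookkeeping of a printed by-analogy step (G-B11-E7) and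
of Prop. 6's own scheme, NOT summit progress.
-/

open Metric Set Filter Topology

namespace Literature.MathematicalPhysics.QuantumFieldTheory.Balaban1983to89.B11Prop6Scheme

open Literature.MathematicalPhysics.QuantumFieldTheory.Balaban1983to89.B13Contraction113
  (QuadAnalytic norm_sub_le_of_sphere_bound differentiableOn_fixedPoint)
open Literature.MathematicalPhysics.QuantumFieldTheory.Balaban1983to89.B8SectDSource
  (fixedPoint_closedBall fixedPoint_mem_of_invariant)

variable {𝒴 𝒵 : Type*} [NormedAddCommGroup 𝒴] [NormedSpace ℂ 𝒴] [NormedAddCommGroup 𝒵] [NormedSpace ℂ 𝒵]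

/-! ## §0. The transformation -/

/-- The transformation whose fixed points are the solutions: `X ↦ −𝒢 J + Λ (X + 𝔄) − 𝒢 (W (X + 𝔄))`.
With Λ = 0 it is (116) p. 295 *«A₁ → −𝔊J − 𝔊((δ/δA′)V)(A₁ + H₁B)»* (𝔄 = H₁B) and, with J = 0 too, (158) p. 302;
with Λ = G̃Δ^{(2)} it is the right-hand side of (143) p. 300 (𝔄 = H₀B) and, with J = 0, of the display before
(180) p. 306.  A definition over abstract spaces; nothing printed is asserted.
[cite: Balaban1985Variational, (116) p.295, (143) p.300, (158) p.302] -/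
def mapT (𝒢 : 𝒵 →L[ℂ] 𝒴) (Λ : 𝒴 →L[ℂ] 𝒴) (W : 𝒴 → 𝒵) (J : 𝒵) (𝔄 : 𝒴) (X : 𝒴) : 𝒴 :=
  -𝒢 J + Λ (X + 𝔄) - 𝒢 (W (X + 𝔄))

/-- Unfolding lemma for `mapT`. [folklore] -/
theorem mapT_apply (𝒢 : 𝒵 →L[ℂ] 𝒴) (Λ : 𝒴 →L[ℂ] 𝒴) (W : 𝒴 → 𝒵) (J : 𝒵) (𝔄 X : 𝒴) :
    mapT 𝒢 Λ W J 𝔄 X = -𝒢 J + Λ (X + 𝔄) - 𝒢 (W (X + 𝔄)) := rfl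

/-- (116) / (180): no linear term. [cite: Balaban1985Variational, (116) p.295] -/
theorem mapT_noLinear (𝒢 : 𝒵 →L[ℂ] 𝒴) (W : 𝒴 → 𝒵) (J : 𝒵) (𝔄 X : 𝒴) :
    mapT 𝒢 0 W J 𝔄 X = -𝒢 J - 𝒢 (W (X + 𝔄)) := by
  simp [mapT]

/-- (158): no linear term and J = 0, *«A₁ + G̃((δ/δA′)V)(A₁ + HB) = 0»*. [cite: Balaban1985Variational, (158) p.302] -/
theorem mapT_158 (𝒢 : 𝒵 →L[ℂ] 𝒴) (W : 𝒴 → 𝒵) (𝔄 X : 𝒴) :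
    mapT 𝒢 0 W 0 𝔄 X = -𝒢 (W (X + 𝔄)) := by
  simp [mapT]

variable {𝒢 : 𝒵 →L[ℂ] 𝒴} {Λ : 𝒴 →L[ℂ] 𝒴} {W : 𝒴 → 𝒵} {B₀ θ C₄ a₃ : ℝ}

/-! ## §1. The scheme (117)–(121), with an optional small linear term -/

/-- The norm of the shifted argument: ‖X‖ ≤ ε₄ and ‖𝔄‖ < a give ‖X + 𝔄‖ < ε₄ + a (the printed «ε₄ + B₀|B|»).
[folklore] -/
theorem norm_arg_lt {E : Type*} [NormedAddCommGroup E] {𝔄 X : E} {a ε₄ : ℝ} (h𝔄 : ‖𝔄‖ < a)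
    (hX : ‖X‖ ≤ ε₄) : ‖X + 𝔄‖ < ε₄ + a :=
  (norm_add_le X 𝔄).trans_lt (by linarith)

/-- **(117)** p. 295, with the θ-term of (143): *«By Theorem 3.13 of [5] the norm … of the transformation can be
estimated by B₀|J|_{(−3)} + B₀|((δ/δA′)V)(A₁ + H₁B)|_{(−3)} < B₀C₁B₃ε₁ + B₀C₄(ε₄ + B₀|B|)², (117) if ε₄ + B₀|B| ≤
a₃»* — here in the form ‖TX‖ ≤ B₀‖J‖ + θ‖X + 𝔄‖ + B₀C₄‖X + 𝔄‖² whenever ‖X + 𝔄‖ < a₃ (θ = 0 printed).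
[cite: Balaban1985Variational, (117) p.295] -/
theorem bound_117 (h𝒢 : ∀ f, ‖𝒢 f‖ ≤ B₀ * ‖f‖) (hΛ : ∀ Y, ‖Λ Y‖ ≤ θ * ‖Y‖)
    (hW : QuadAnalytic W C₄ a₃) (hB₀ : 0 ≤ B₀) {J : 𝒵} {𝔄 X : 𝒴} (harg : ‖X + 𝔄‖ < a₃) :
    ‖mapT 𝒢 Λ W J 𝔄 X‖ ≤ B₀ * ‖J‖ + θ * ‖X + 𝔄‖ + B₀ * C₄ * ‖X + 𝔄‖ ^ 2 := by
  have h1 : ‖-𝒢 J‖ ≤ B₀ * ‖J‖ := by rw [norm_neg]; exact h𝒢 J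
  have h2 : ‖Λ (X + 𝔄)‖ ≤ θ * ‖X + 𝔄‖ := hΛ _
  have h3 : ‖𝒢 (W (X + 𝔄))‖ ≤ B₀ * C₄ * ‖X + 𝔄‖ ^ 2 := by
    calc ‖𝒢 (W (X + 𝔄))‖ ≤ B₀ * ‖W (X + 𝔄)‖ := h𝒢 _
      _ ≤ B₀ * (C₄ * ‖X + 𝔄‖ ^ 2) := mul_le_mul_of_nonneg_left (hW.quad _ harg) hB₀
      _ = B₀ * C₄ * ‖X + 𝔄‖ ^ 2 := by ring
  calc ‖mapT 𝒢 Λ W J 𝔄 X‖ = ‖(-𝒢 J + Λ (X + 𝔄)) - 𝒢 (W (X + 𝔄))‖ := rfl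
    _ ≤ ‖-𝒢 J + Λ (X + 𝔄)‖ + ‖𝒢 (W (X + 𝔄))‖ := norm_sub_le _ _
    _ ≤ (‖-𝒢 J‖ + ‖Λ (X + 𝔄)‖) + ‖𝒢 (W (X + 𝔄))‖ := by
        gcongr; exact norm_add_le _ _
    _ ≤ B₀ * ‖J‖ + θ * ‖X + 𝔄‖ + B₀ * C₄ * ‖X + 𝔄‖ ^ 2 := by linarith

/-- **(118): the transformation maps the space (115) into itself** (p. 295 *«hence the transformation (116)
transforms the space (115) into itself if ε₄ + 2dLB₀C₁ε₁ ≤ a₃, B₀C₁B₃ε₁ + B₀C₄(ε₄ + 2dLB₀C₁ε₁)² ≤ ε₄. (118)»*),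
typed on the closed ball ‖X‖ ≤ ε₄ of the abstract space and with the θ-term: if ‖J‖ ≤ j, ‖𝔄‖ < a, ε₄ + a ≤ a₃ and
B₀j + θ(ε₄ + a) + B₀C₄(ε₄ + a)² ≤ ε₄, then ‖X‖ ≤ ε₄ ⟹ ‖TX‖ ≤ ε₄.  (Printed: θ = 0, j = C₁B₃ε₁, a = 2dLB₀C₁ε₁.)
[cite: Balaban1985Variational, (118) p.295] -/
theorem mapsTo_118 (h𝒢 : ∀ f, ‖𝒢 f‖ ≤ B₀ * ‖f‖) (hΛ : ∀ Y, ‖Λ Y‖ ≤ θ * ‖Y‖) (hW : QuadAnalytic W C₄ a₃)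
    (hB₀ : 0 ≤ B₀) (hC₄ : 0 ≤ C₄) (hθ : 0 ≤ θ) {J : 𝒵} {j : ℝ} (hJ : ‖J‖ ≤ j) {𝔄 : 𝒴} {a ε₄ : ℝ}
    (h𝔄 : ‖𝔄‖ < a) (hdom : ε₄ + a ≤ a₃) (hself : B₀ * j + θ * (ε₄ + a) + B₀ * C₄ * (ε₄ + a) ^ 2 ≤ ε₄) :
    ∀ X : 𝒴, ‖X‖ ≤ ε₄ → ‖mapT 𝒢 Λ W J 𝔄 X‖ ≤ ε₄ := by
  intro X hX
  have hm : ‖X + 𝔄‖ < ε₄ + a := norm_arg_lt h𝔄 hX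
  have hm0 : 0 ≤ ‖X + 𝔄‖ := norm_nonneg _
  have h := bound_117 (J := J) h𝒢 hΛ hW hB₀ (hm.trans_le hdom)
  have e1 : B₀ * ‖J‖ ≤ B₀ * j := mul_le_mul_of_nonneg_left hJ hB₀
  have e2 : θ * ‖X + 𝔄‖ ≤ θ * (ε₄ + a) := mul_le_mul_of_nonneg_left hm.le hθ
  have e3 : B₀ * C₄ * ‖X + 𝔄‖ ^ 2 ≤ B₀ * C₄ * (ε₄ + a) ^ 2 :=
    mul_le_mul_of_nonneg_left (pow_le_pow_left₀ hm0 hm.le 2) (mul_nonneg hB₀ hC₄)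
  linarith

/-- **(119)–(120): the contraction estimate by the Cauchy formula** (p. 295, quoted in the header): for X₁, X₂ in
the ball ‖X‖ ≤ ε₄, with h(ζ) = W(X₂ + 𝔄 + ζ(X₁ − X₂)) holomorphic along the line, the points of the segment have
norm < ε₄ + a and the circles |ζ − t| = r with *«r = (ε₄ + B₀|B|)(max{…})⁻¹»* (here r = (ε₄ + a)‖X₁ − X₂‖⁻¹) stay
in the ball of radius 2(ε₄ + a) ≤ a₃ (*«We have to assume also that 2(ε₄ + B₀|B|) ≤ a₃, in order to be able to apply
Proposition 4»*), where ‖h‖ ≤ C₄(2(ε₄ + a))²; Cauchy's estimate and the mean-value inequality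
(`B13Contraction113.norm_sub_le_of_sphere_bound`) give ‖W(X₁ + 𝔄) − W(X₂ + 𝔄)‖ ≤ 4C₄(ε₄ + a)‖X₁ − X₂‖, whence the
Lipschitz constant θ + 4B₀C₄(ε₄ + a) — for θ = 0 exactly the printed *«= 4B₀C₄(ε₄ + B₀|B|)max{|A₁ − A₂|_{(−1)},
|∇(A₁ − A₂)|_{(−2)}}, (120)»*. [cite: Balaban1985Variational, (119)-(120) p.295] -/
theorem lipschitz_120 (h𝒢 : ∀ f, ‖𝒢 f‖ ≤ B₀ * ‖f‖) (hΛ : ∀ Y, ‖Λ Y‖ ≤ θ * ‖Y‖) (hW : QuadAnalytic W C₄ a₃)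
    (hB₀ : 0 ≤ B₀) (hC₄ : 0 ≤ C₄) {J : 𝒵} {𝔄 : 𝒴} {a ε₄ : ℝ} (h𝔄 : ‖𝔄‖ < a) (hε₄ : 0 ≤ ε₄)
    (hdom : 2 * (ε₄ + a) ≤ a₃) {X₁ X₂ : 𝒴} (h₁ : ‖X₁‖ ≤ ε₄) (h₂ : ‖X₂‖ ≤ ε₄) :
    ‖mapT 𝒢 Λ W J 𝔄 X₁ - mapT 𝒢 Λ W J 𝔄 X₂‖ ≤ (θ + 4 * B₀ * C₄ * (ε₄ + a)) * ‖X₁ - X₂‖ := by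
  set m : ℝ := ε₄ + a with hm
  have ha : 0 < a := (norm_nonneg _).trans_lt h𝔄
  have hmpos : 0 < m := by rw [hm]; linarith
  -- the quadratic part, by the Cauchy formula along the segment
  have hWpart : ‖W (X₁ + 𝔄) - W (X₂ + 𝔄)‖ ≤ 4 * C₄ * m * ‖X₁ - X₂‖ := by
    set Q : 𝒴 := X₁ - X₂ with hQ
    set P : 𝒴 := X₂ + 𝔄 with hP
    set h : ℂ → 𝒵 := fun ζ => W (P + ζ • Q) with hh
    have h0 : h 0 = W (X₂ + 𝔄) := by simp [hh, hP]
    have h1 : h 1 = W (X₁ + 𝔄) := by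
      simp only [hh, hP, hQ, one_smul]
      congr 1
      abel
    by_cases hQ0 : ‖Q‖ = 0
    · have hx : X₁ = X₂ := sub_eq_zero.mp (norm_eq_zero.mp hQ0)
      have h0' : W (X₁ + 𝔄) - W P = 0 := by rw [hP, hx, sub_self]
      simp [h0', hQ0]
    have hQpos : 0 < ‖Q‖ := lt_of_le_of_ne (norm_nonneg _) (Ne.symm hQ0)
    set r : ℝ := m / ‖Q‖ with hr
    have hrpos : 0 < r := div_pos hmpos hQpos
    have hrQ : r * ‖Q‖ = m := by rw [hr, div_mul_cancel₀ _ (ne_of_gt hQpos)]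
    -- the points of the segment lie in the open ball of radius m
    have hseg : ∀ t : ℝ, t ∈ Icc (0:ℝ) 1 → ‖P + (t : ℂ) • Q‖ < m := by
      intro t ht
      have hconv := (convex_closedBall (0:𝒴) ε₄) (mem_closedBall_zero_iff.2 h₂)
        (mem_closedBall_zero_iff.2 h₁) (sub_nonneg.mpr ht.2) ht.1 (by ring)
      have heq : (1 - t) • X₂ + t • X₁ = X₂ + (t : ℂ) • Q := by
        rw [hQ, Complex.coe_smul, smul_sub, sub_smul, one_smul]
        abel
      rw [heq, mem_closedBall_zero_iff] at hconv
      have hsplit : P + (t : ℂ) • Q = (X₂ + (t : ℂ) • Q) + 𝔄 := by rw [hP]; abel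
      rw [hsplit]
      calc ‖X₂ + (t : ℂ) • Q + 𝔄‖ ≤ ‖X₂ + (t : ℂ) • Q‖ + ‖𝔄‖ := norm_add_le _ _
        _ < ε₄ + a := add_lt_add_of_le_of_lt hconv h𝔄
        _ = m := by rw [hm]
    -- the discs of radius r around the segment lie in the ball of radius 2m ≤ a₃
    have hdisc : ∀ t : ℝ, t ∈ Icc (0:ℝ) 1 → ∀ z ∈ closedBall (t : ℂ) r, ‖P + z • Q‖ < 2 * m := by
      intro t ht z hz
      rw [mem_closedBall, dist_eq_norm] at hz
      have hsplit : P + z • Q = (P + (t : ℂ) • Q) + (z - t) • Q := by rw [sub_smul]; abel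
      calc ‖P + z • Q‖ = ‖(P + (t : ℂ) • Q) + (z - t) • Q‖ := by rw [hsplit]
        _ ≤ ‖P + (t : ℂ) • Q‖ + ‖(z - t) • Q‖ := norm_add_le _ _
        _ = ‖P + (t : ℂ) • Q‖ + ‖z - (t : ℂ)‖ * ‖Q‖ := by rw [norm_smul]
        _ ≤ ‖P + (t : ℂ) • Q‖ + r * ‖Q‖ := by gcongr
        _ < m + m := add_lt_add_of_lt_of_le (hseg t ht) hrQ.le
        _ = 2 * m := by ring
    have hU : IsOpen {ζ : ℂ | ‖P + ζ • Q‖ < a₃} :=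
      isOpen_lt (continuous_const.add (continuous_id.smul continuous_const)).norm continuous_const
    have hsub : ∀ t : ℝ, t ∈ Icc (0:ℝ) 1 → closedBall (t : ℂ) r ⊆ {ζ : ℂ | ‖P + ζ • Q‖ < a₃} :=
      fun t ht z hz => (hdisc t ht z hz).trans_le (by rw [hm]; exact hdom)
    have hM : ∀ t : ℝ, t ∈ Icc (0:ℝ) 1 → ∀ z ∈ sphere (t : ℂ) r, ‖h z‖ ≤ C₄ * (2 * m) ^ 2 := by
      intro t ht z hz
      have hlt := hdisc t ht z (sphere_subset_closedBall hz)
      calc ‖h z‖ = ‖W (P + z • Q)‖ := rfl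
        _ ≤ C₄ * ‖P + z • Q‖ ^ 2 := hW.quad _ (hlt.trans_le (by rw [hm]; exact hdom))
        _ ≤ C₄ * (2 * m) ^ 2 := mul_le_mul_of_nonneg_left (pow_le_pow_left₀ (norm_nonneg _) hlt.le 2) hC₄
    have main : ‖h 1 - h 0‖ ≤ C₄ * (2 * m) ^ 2 / r :=
      norm_sub_le_of_sphere_bound hU (hW.lineAnalytic P Q) hrpos hsub hM
    rw [h1, h0] at main
    calc ‖W (X₁ + 𝔄) - W (X₂ + 𝔄)‖ ≤ C₄ * (2 * m) ^ 2 / r := main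
      _ = 4 * C₄ * m * ‖Q‖ := by
          rw [hr]
          field_simp
          ring
  -- assemble: the J-terms cancel, the linear term contributes θ
  have hdiff : mapT 𝒢 Λ W J 𝔄 X₁ - mapT 𝒢 Λ W J 𝔄 X₂ =
      Λ (X₁ - X₂) - 𝒢 (W (X₁ + 𝔄) - W (X₂ + 𝔄)) := by
    simp only [mapT, map_sub, map_add]
    abel
  rw [hdiff]
  have t1 : ‖Λ (X₁ - X₂)‖ ≤ θ * ‖X₁ - X₂‖ := hΛ _
  have t2 : ‖𝒢 (W (X₁ + 𝔄) - W (X₂ + 𝔄))‖ ≤ B₀ * (4 * C₄ * m * ‖X₁ - X₂‖) :=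
    (h𝒢 _).trans (mul_le_mul_of_nonneg_left hWpart hB₀)
  calc ‖Λ (X₁ - X₂) - 𝒢 (W (X₁ + 𝔄) - W (X₂ + 𝔄))‖
      ≤ ‖Λ (X₁ - X₂)‖ + ‖𝒢 (W (X₁ + 𝔄) - W (X₂ + 𝔄))‖ := norm_sub_le _ _
    _ ≤ θ * ‖X₁ - X₂‖ + B₀ * (4 * C₄ * m * ‖X₁ - X₂‖) := add_le_add t1 t2
    _ = (θ + 4 * B₀ * C₄ * m) * ‖X₁ - X₂‖ := by ring

/-- **Exactly one solution in the ball** — Prop. 6's *«Eq. (111) has exactly one solution in the space (115)»* as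
the contraction mapping theorem on the complete set ‖X‖ ≤ ε₄ (`B8SectDSource.fixedPoint_closedBall`): self-map by
(118) [θ-extended], Lipschitz constant θ + 4B₀C₄(ε₄ + a) < 1 by (120)–(121) (printed: ≤ ½).
[cite: Balaban1985Variational, Prop. 6 p.295] -/
theorem existsUnique_solution [CompleteSpace 𝒴] (h𝒢 : ∀ f, ‖𝒢 f‖ ≤ B₀ * ‖f‖) (hΛ : ∀ Y, ‖Λ Y‖ ≤ θ * ‖Y‖)
    (hW : QuadAnalytic W C₄ a₃) (hB₀ : 0 ≤ B₀) (hC₄ : 0 ≤ C₄) (hθ : 0 ≤ θ) {J : 𝒵} {j : ℝ} (hJ : ‖J‖ ≤ j)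
    {𝔄 : 𝒴} {a ε₄ : ℝ} (h𝔄 : ‖𝔄‖ < a) (hε₄ : 0 ≤ ε₄) (hdom : 2 * (ε₄ + a) ≤ a₃)
    (hself : B₀ * j + θ * (ε₄ + a) + B₀ * C₄ * (ε₄ + a) ^ 2 ≤ ε₄)
    (hcontr : θ + 4 * B₀ * C₄ * (ε₄ + a) < 1) :
    ∃! X : 𝒴, ‖X‖ ≤ ε₄ ∧ mapT 𝒢 Λ W J 𝔄 X = X := by
  have ha : 0 < a := (norm_nonneg _).trans_lt h𝔄
  have hdom1 : ε₄ + a ≤ a₃ := by linarith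
  have hκ0 : 0 ≤ θ + 4 * B₀ * C₄ * (ε₄ + a) := by positivity
  exact fixedPoint_closedBall (mapT 𝒢 Λ W J 𝔄) hε₄ hκ0 hcontr
    (mapsTo_118 h𝒢 hΛ hW hB₀ hC₄ hθ hJ h𝔄 hdom1 hself)
    (fun x y hx hy => lipschitz_120 (J := J) h𝒢 hΛ hW hB₀ hC₄ h𝔄 hε₄ hdom hx hy)

/-- **Nested balls** — the argument behind *«This solution satisfies the bounds (115) with ε₄ = 3B₀C₁B₃ε₁»*: if the
self-map condition also holds at a smaller radius ε₄′ ≤ ε₄, the solution found in the ε₄-ball already lies in the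
ε₄′-ball (existence there, uniqueness in the larger ball).  [cite: Balaban1985Variational, Prop. 6 p.295] -/
theorem norm_solution_le [CompleteSpace 𝒴] (h𝒢 : ∀ f, ‖𝒢 f‖ ≤ B₀ * ‖f‖) (hΛ : ∀ Y, ‖Λ Y‖ ≤ θ * ‖Y‖)
    (hW : QuadAnalytic W C₄ a₃) (hB₀ : 0 ≤ B₀) (hC₄ : 0 ≤ C₄) (hθ : 0 ≤ θ) {J : 𝒵} {j : ℝ} (hJ : ‖J‖ ≤ j)
    {𝔄 : 𝒴} {a ε₄ : ℝ} (h𝔄 : ‖𝔄‖ < a) (hε₄ : 0 ≤ ε₄) (hdom : 2 * (ε₄ + a) ≤ a₃)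
    (hself : B₀ * j + θ * (ε₄ + a) + B₀ * C₄ * (ε₄ + a) ^ 2 ≤ ε₄)
    (hcontr : θ + 4 * B₀ * C₄ * (ε₄ + a) < 1) {ε₄' : ℝ} (hε₄' : 0 ≤ ε₄') (hle : ε₄' ≤ ε₄)
    (hself' : B₀ * j + θ * (ε₄' + a) + B₀ * C₄ * (ε₄' + a) ^ 2 ≤ ε₄')
    {X : 𝒴} (hX : ‖X‖ ≤ ε₄) (hfix : mapT 𝒢 Λ W J 𝔄 X = X) : ‖X‖ ≤ ε₄' := by
  have hdom' : 2 * (ε₄' + a) ≤ a₃ := by linarith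
  have hmono : 4 * B₀ * C₄ * (ε₄' + a) ≤ 4 * B₀ * C₄ * (ε₄ + a) :=
    mul_le_mul_of_nonneg_left (by linarith) (by positivity)
  have hcontr' : θ + 4 * B₀ * C₄ * (ε₄' + a) < 1 := by linarith
  obtain ⟨X', ⟨hX'n, hX'fix⟩, -⟩ :=
    existsUnique_solution h𝒢 hΛ hW hB₀ hC₄ hθ hJ h𝔄 hε₄' hdom' hself' hcontr'
  obtain ⟨X₀, -, huniq⟩ := existsUnique_solution h𝒢 hΛ hW hB₀ hC₄ hθ hJ h𝔄 hε₄ hdom hself hcontr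
  have e1 : X = X₀ := huniq X ⟨hX, hfix⟩
  have e2 : X' = X₀ := huniq X' ⟨hX'n.trans hle, hX'fix⟩
  rw [e1, ← e2]
  exact hX'n

/-- **The solution lies in every closed invariant set containing 0** (`B8SectDSource.fixedPoint_mem_of_invariant`):
used for the constraint space of (115) and for reality of the solution. [folklore] -/
theorem solution_mem_of_invariant [CompleteSpace 𝒴] (h𝒢 : ∀ f, ‖𝒢 f‖ ≤ B₀ * ‖f‖)
    (hΛ : ∀ Y, ‖Λ Y‖ ≤ θ * ‖Y‖) (hW : QuadAnalytic W C₄ a₃) (hB₀ : 0 ≤ B₀) (hC₄ : 0 ≤ C₄) (hθ : 0 ≤ θ)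
    {J : 𝒵} {j : ℝ} (hJ : ‖J‖ ≤ j) {𝔄 : 𝒴} {a ε₄ : ℝ} (h𝔄 : ‖𝔄‖ < a) (hε₄ : 0 ≤ ε₄)
    (hdom : 2 * (ε₄ + a) ≤ a₃) (hself : B₀ * j + θ * (ε₄ + a) + B₀ * C₄ * (ε₄ + a) ^ 2 ≤ ε₄)
    (hcontr : θ + 4 * B₀ * C₄ * (ε₄ + a) < 1) (S : Set 𝒴) (hS : IsClosed S) (h0 : (0:𝒴) ∈ S)
    (hinv : ∀ X ∈ S, ‖X‖ ≤ ε₄ → mapT 𝒢 Λ W J 𝔄 X ∈ S) {X : 𝒴} (hX : ‖X‖ ≤ ε₄)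
    (hfix : mapT 𝒢 Λ W J 𝔄 X = X) : X ∈ S := by
  have ha : 0 < a := (norm_nonneg _).trans_lt h𝔄
  have hdom1 : ε₄ + a ≤ a₃ := by linarith
  have hκ0 : 0 ≤ θ + 4 * B₀ * C₄ * (ε₄ + a) := by positivity
  exact fixedPoint_mem_of_invariant (mapT 𝒢 Λ W J 𝔄) hε₄ hκ0 hcontr
    (mapsTo_118 h𝒢 hΛ hW hB₀ hC₄ hθ hJ h𝔄 hdom1 hself)
    (fun x y hx hy => lipschitz_120 (J := J) h𝒢 hΛ hW hB₀ hC₄ h𝔄 hε₄ hdom hx hy) S hS h0 hinv hX hfix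

/-- **(P1) — the constraint space.**  If a closed subspace `S` contains the ranges of 𝒢 and Λ (p. 294: 𝔊 = G₁𝔓*
satisfies *«Q𝔊 = 0, RD*𝔊 = 0»*; for (143): the range of G̃ = GP₀* lies in {QA = 0}), the solution lies in `S`:
«exactly one solution in the space (115)» with its constraints, and C-adv7-12 (f)'s reading «exactly one solution in
{QA₀ = 0} ∩ (115)-bounds» for (143). [cite: Balaban1985Variational, (111) p.294, (143) p.300] -/
theorem solution_mem_submodule [CompleteSpace 𝒴] (h𝒢 : ∀ f, ‖𝒢 f‖ ≤ B₀ * ‖f‖)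
    (hΛ : ∀ Y, ‖Λ Y‖ ≤ θ * ‖Y‖) (hW : QuadAnalytic W C₄ a₃) (hB₀ : 0 ≤ B₀) (hC₄ : 0 ≤ C₄) (hθ : 0 ≤ θ)
    {J : 𝒵} {j : ℝ} (hJ : ‖J‖ ≤ j) {𝔄 : 𝒴} {a ε₄ : ℝ} (h𝔄 : ‖𝔄‖ < a) (hε₄ : 0 ≤ ε₄)
    (hdom : 2 * (ε₄ + a) ≤ a₃) (hself : B₀ * j + θ * (ε₄ + a) + B₀ * C₄ * (ε₄ + a) ^ 2 ≤ ε₄)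
    (hcontr : θ + 4 * B₀ * C₄ * (ε₄ + a) < 1) (S : Submodule ℂ 𝒴) (hS : IsClosed (S : Set 𝒴))
    (h𝒢S : ∀ f, 𝒢 f ∈ S) (hΛS : ∀ Y, Λ Y ∈ S) {X : 𝒴} (hX : ‖X‖ ≤ ε₄)
    (hfix : mapT 𝒢 Λ W J 𝔄 X = X) : X ∈ (S : Set 𝒴) := by
  refine solution_mem_of_invariant h𝒢 hΛ hW hB₀ hC₄ hθ hJ h𝔄 hε₄ hdom hself hcontr (S : Set 𝒴) hS
    S.zero_mem (fun Y _ _ => ?_) hX hfix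
  show -𝒢 J + Λ (Y + 𝔄) - 𝒢 (W (Y + 𝔄)) ∈ S
  exact S.sub_mem (S.add_mem (S.neg_mem (h𝒢S J)) (hΛS _)) (h𝒢S _)

/-! ## §2. Proposition 6 as printed (θ = 0) -/

/-- The admissible a₄ of C-B11-E1 and C-adv7-1: ε₄ ≤ min{a₃⁄4, (16B₀C₄)⁻¹} iff 4ε₄ ≤ a₃ and 16B₀C₄ε₄ ≤ 1 (for
B₀C₄ > 0).  Real arithmetic. [cite: Balaban1985Variational, (118)-(121) p.295] -/
theorem le_a4_iff {B₀ C₄ a₃ ε₄ : ℝ} (hpos : 0 < B₀ * C₄) :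
    ε₄ ≤ min (a₃ / 4) (1 / (16 * B₀ * C₄)) ↔ 4 * ε₄ ≤ a₃ ∧ 16 * B₀ * C₄ * ε₄ ≤ 1 := by
  have h16 : 0 < 16 * B₀ * C₄ := by linarith
  rw [le_min_iff, le_div_iff₀ (by norm_num : (0:ℝ) < 4), le_div_iff₀ h16]
  constructor
  · rintro ⟨h1, h2⟩; exact ⟨by linarith, by linarith⟩
  · rintro ⟨h1, h2⟩; exact ⟨by linarith, by linarith⟩

/-- **Proposition 6, first two clauses, as printed (θ = 0)**: under *«ε₄ ≤ a₄ and ε₁ satisfying 2B₀C₁B₃ε₁ ≤ ε₄»*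
(a₄ unfolded as 4ε₄ ≤ a₃ ∧ 16B₀C₄ε₄ ≤ 1, and dL ≤ B₃ — true for the B₃ of (162)), with ‖J‖ ≤ C₁B₃ε₁ and ‖𝔄‖ <
2dLB₀C₁ε₁, the conditions (118) and (121) hold (`B11.ineq118_121`), the transformation (116) has EXACTLY ONE fixed
point in ‖X‖ ≤ ε₄, and that fixed point satisfies ‖X‖ ≤ 2B₀C₁B₃ε₁ (nested balls at ε₄′ = 2B₀C₁B₃ε₁).
[cite: Balaban1985Variational, Prop. 6 p.295] -/
theorem prop6_solution [CompleteSpace 𝒴] (h𝒢 : ∀ f, ‖𝒢 f‖ ≤ B₀ * ‖f‖) (hW : QuadAnalytic W C₄ a₃)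
    (hB₀ : 0 ≤ B₀) (hC₄ : 0 ≤ C₄) {dL C₁ B₃ ε₁ ε₄ : ℝ} (hdL : 0 ≤ dL) (hC₁ : 0 ≤ C₁) (hε₁ : 0 ≤ ε₁)
    (hε₄ : 0 ≤ ε₄) (hB₃ : dL ≤ B₃) (h1 : 2 * B₀ * C₁ * B₃ * ε₁ ≤ ε₄) (h2 : 4 * ε₄ ≤ a₃)
    (h3 : 16 * B₀ * C₄ * ε₄ ≤ 1) {J : 𝒵} (hJ : ‖J‖ ≤ C₁ * B₃ * ε₁) {𝔄 : 𝒴}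
    (h𝔄 : ‖𝔄‖ < 2 * dL * B₀ * C₁ * ε₁) :
    (∃! X : 𝒴, ‖X‖ ≤ ε₄ ∧ mapT 𝒢 0 W J 𝔄 X = X) ∧
      ∀ X : 𝒴, ‖X‖ ≤ ε₄ → mapT 𝒢 0 W J 𝔄 X = X → ‖X‖ ≤ 2 * B₀ * C₁ * B₃ * ε₁ := by
  have hΛ : ∀ Y : 𝒴, ‖(0 : 𝒴 →L[ℂ] 𝒴) Y‖ ≤ 0 * ‖Y‖ := fun Y => by simp
  -- the printed conditions (118), (121) at ε₄
  obtain ⟨⟨-, h118⟩, ⟨h121a, h121b⟩⟩ :=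
    B11.ineq118_121 dL B₀ C₁ C₄ B₃ a₃ ε₁ ε₄ hdL hB₀ hC₁ hC₄ hε₁ hε₄ hB₃ h1 h2 h3
  have hdom : 2 * (ε₄ + 2 * dL * B₀ * C₁ * ε₁) ≤ a₃ := by linarith
  have hself : B₀ * (C₁ * B₃ * ε₁) + 0 * (ε₄ + 2 * dL * B₀ * C₁ * ε₁) +
      B₀ * C₄ * (ε₄ + 2 * dL * B₀ * C₁ * ε₁) ^ 2 ≤ ε₄ := by
    have : B₀ * (C₁ * B₃ * ε₁) = B₀ * C₁ * B₃ * ε₁ := by ring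
    rw [this, zero_mul, add_zero]; exact h118
  have hcontr : 0 + 4 * B₀ * C₄ * (ε₄ + 2 * dL * B₀ * C₁ * ε₁) < 1 := by linarith
  refine ⟨existsUnique_solution h𝒢 hΛ hW hB₀ hC₄ le_rfl hJ h𝔄 hε₄ hdom hself hcontr, fun X hX hfix => ?_⟩
  -- the same conditions at the smaller radius ε₄' = 2B₀C₁B₃ε₁
  set ε₄' : ℝ := 2 * B₀ * C₁ * B₃ * ε₁ with hε₄'def
  have hB₃0 : 0 ≤ B₃ := hdL.trans hB₃
  have hε₄'0 : 0 ≤ ε₄' := by rw [hε₄'def]; positivity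
  have h2' : 4 * ε₄' ≤ a₃ := by linarith
  have h3' : 16 * B₀ * C₄ * ε₄' ≤ 1 :=
    (mul_le_mul_of_nonneg_left h1 (by positivity)).trans h3
  obtain ⟨⟨-, h118'⟩, -⟩ :=
    B11.ineq118_121 dL B₀ C₁ C₄ B₃ a₃ ε₁ ε₄' hdL hB₀ hC₁ hC₄ hε₁ hε₄'0 hB₃ le_rfl h2' h3'
  have hself' : B₀ * (C₁ * B₃ * ε₁) + 0 * (ε₄' + 2 * dL * B₀ * C₁ * ε₁) +
      B₀ * C₄ * (ε₄' + 2 * dL * B₀ * C₁ * ε₁) ^ 2 ≤ ε₄' := by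
    have : B₀ * (C₁ * B₃ * ε₁) = B₀ * C₁ * B₃ * ε₁ := by ring
    rw [this, zero_mul, add_zero]; exact h118'
  exact norm_solution_le h𝒢 hΛ hW hB₀ hC₄ le_rfl hJ h𝔄 hε₄ hdom hself hcontr hε₄'0 h1 hself' hX hfix

/-- The printed constant: ‖X‖ ≤ 2B₀C₁B₃ε₁ < 3B₀C₁B₃ε₁ as soon as B₀C₁B₃ε₁ > 0 — *«This solution satisfies the bounds
(115) with ε₄ = 3B₀C₁B₃ε₁»* ((115) has strict inequalities).  Real arithmetic. [cite: Balaban1985Variational, Prop. 6 p.295] -/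
theorem prop6_bound_printed {B₀ C₁ B₃ ε₁ n : ℝ} (hpos : 0 < B₀ * C₁ * B₃ * ε₁)
    (hn : n ≤ 2 * B₀ * C₁ * B₃ * ε₁) : n < 3 * B₀ * C₁ * B₃ * ε₁ := by
  linarith

/-! ## §3. Eq. (143): «Proposition 6 is valid for it also» (G-B11-E7) -/

/-- **The arithmetic of the transfer to (143)** — the located content of «Proposition 6 is valid for it also»: under
Prop. 6's own hypotheses 2B₀C₁B₃ε₁ ≤ ε₄, 4ε₄ ≤ a₃, 16B₀C₄ε₄ ≤ 1, dL ≤ B₃ and the ONE extra condition 8θ ≤ 1 on the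
norm θ of the linear term G̃Δ^{(2)}: the Prop.-4 domain condition 2(ε₄ + a) ≤ a₃, the θ-extended (118)
B₀C₁B₃ε₁ + θ(ε₄ + a) + B₀C₄(ε₄ + a)² ≤ ε₄ (the three terms are ≤ ε₄⁄2, ε₄⁄4, ε₄⁄4), and the contraction constant
θ + 4B₀C₄(ε₄ + a) ≤ 5⁄8, where a = 2dLB₀C₁ε₁ (≤ ε₄).  Real arithmetic. [cite: Balaban1985Variational, (143) p.300] -/
theorem conditions_143 {dL B₀ C₁ C₄ B₃ a₃ ε₁ ε₄ θ : ℝ} (hdL : 0 ≤ dL) (hB₀ : 0 ≤ B₀) (hC₁ : 0 ≤ C₁)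
    (hC₄ : 0 ≤ C₄) (hε₁ : 0 ≤ ε₁) (hε₄ : 0 ≤ ε₄) (hB₃ : dL ≤ B₃) (h1 : 2 * B₀ * C₁ * B₃ * ε₁ ≤ ε₄)
    (h2 : 4 * ε₄ ≤ a₃) (h3 : 16 * B₀ * C₄ * ε₄ ≤ 1) (hθ0 : 0 ≤ θ) (hθ : 8 * θ ≤ 1) :
    2 * (ε₄ + 2 * dL * B₀ * C₁ * ε₁) ≤ a₃ ∧
      B₀ * (C₁ * B₃ * ε₁) + θ * (ε₄ + 2 * dL * B₀ * C₁ * ε₁) +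
        B₀ * C₄ * (ε₄ + 2 * dL * B₀ * C₁ * ε₁) ^ 2 ≤ ε₄ ∧
      θ + 4 * B₀ * C₄ * (ε₄ + 2 * dL * B₀ * C₁ * ε₁) ≤ 5 / 8 := by
  set a : ℝ := 2 * dL * B₀ * C₁ * ε₁ with hadef
  have hp : 0 ≤ B₀ * C₁ * ε₁ := by positivity
  have ha0 : 0 ≤ a := by rw [hadef]; positivity
  have haε : a ≤ ε₄ := by
    have : dL * (B₀ * C₁ * ε₁) ≤ B₃ * (B₀ * C₁ * ε₁) := mul_le_mul_of_nonneg_right hB₃ hp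
    rw [hadef]; nlinarith
  have hm : ε₄ + a ≤ 2 * ε₄ := by linarith
  have hm0 : 0 ≤ ε₄ + a := by linarith
  -- the three terms of the self-map condition
  have tJ : B₀ * (C₁ * B₃ * ε₁) ≤ ε₄ / 2 := by nlinarith
  have tθ : θ * (ε₄ + a) ≤ ε₄ / 4 := by
    have e1 : θ * (ε₄ + a) ≤ θ * (2 * ε₄) := mul_le_mul_of_nonneg_left hm hθ0
    have e2 : 8 * θ * ε₄ ≤ 1 * ε₄ := mul_le_mul_of_nonneg_right hθ hε₄
    nlinarith
  have tC : B₀ * C₄ * (ε₄ + a) ^ 2 ≤ ε₄ / 4 := by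
    have e1 : (ε₄ + a) ^ 2 ≤ (2 * ε₄) ^ 2 := pow_le_pow_left₀ hm0 hm 2
    have e2 : B₀ * C₄ * (ε₄ + a) ^ 2 ≤ B₀ * C₄ * (2 * ε₄) ^ 2 := mul_le_mul_of_nonneg_left e1 (by positivity)
    have e3 : 16 * B₀ * C₄ * ε₄ * ε₄ ≤ 1 * ε₄ := mul_le_mul_of_nonneg_right h3 hε₄
    nlinarith
  -- the contraction constant
  have cC : 4 * B₀ * C₄ * (ε₄ + a) ≤ 1 / 2 := by
    have e1 : 4 * B₀ * C₄ * (ε₄ + a) ≤ 4 * B₀ * C₄ * (2 * ε₄) := mul_le_mul_of_nonneg_left hm (by positivity)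
    nlinarith
  refine ⟨by linarith, by linarith, by linarith⟩

/-- **Eq. (143), «Proposition 6 is valid for it also» (G-B11-E7; C-adv7-12 (e)), kernel form.**  For the map
X ↦ −G̃J + G̃Δ^{(2)}(X + 𝔄) − G̃((δ/δA′)V)(X + 𝔄) (𝔄 = H₀B), with ‖G̃f‖ ≤ B₀‖f‖, ‖G̃Δ^{(2)}Y‖ ≤ θ‖Y‖, Prop. 4 for
W: under Prop. 6's printed hypotheses (2B₀C₁B₃ε₁ ≤ ε₄, 4ε₄ ≤ a₃, 16B₀C₄ε₄ ≤ 1, dL ≤ B₃, ‖J‖ ≤ C₁B₃ε₁, ‖𝔄‖ <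
2dLB₀C₁ε₁) and 8θ ≤ 1, there is EXACTLY ONE solution with ‖X‖ ≤ ε₄, and it satisfies ‖X‖ ≤ 2B₀C₁B₃ε₁ — the
statement of Proposition 6 with the same a₄.  [cite: Balaban1985Variational, (143) p.300] -/
theorem eq143_solution [CompleteSpace 𝒴] (h𝒢 : ∀ f, ‖𝒢 f‖ ≤ B₀ * ‖f‖) (hΛ : ∀ Y, ‖Λ Y‖ ≤ θ * ‖Y‖)
    (hW : QuadAnalytic W C₄ a₃) (hB₀ : 0 ≤ B₀) (hC₄ : 0 ≤ C₄) (hθ0 : 0 ≤ θ) (hθ : 8 * θ ≤ 1)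
    {dL C₁ B₃ ε₁ ε₄ : ℝ} (hdL : 0 ≤ dL) (hC₁ : 0 ≤ C₁) (hε₁ : 0 ≤ ε₁) (hε₄ : 0 ≤ ε₄) (hB₃ : dL ≤ B₃)
    (h1 : 2 * B₀ * C₁ * B₃ * ε₁ ≤ ε₄) (h2 : 4 * ε₄ ≤ a₃) (h3 : 16 * B₀ * C₄ * ε₄ ≤ 1) {J : 𝒵}
    (hJ : ‖J‖ ≤ C₁ * B₃ * ε₁) {𝔄 : 𝒴} (h𝔄 : ‖𝔄‖ < 2 * dL * B₀ * C₁ * ε₁) :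
    (∃! X : 𝒴, ‖X‖ ≤ ε₄ ∧ mapT 𝒢 Λ W J 𝔄 X = X) ∧
      ∀ X : 𝒴, ‖X‖ ≤ ε₄ → mapT 𝒢 Λ W J 𝔄 X = X → ‖X‖ ≤ 2 * B₀ * C₁ * B₃ * ε₁ := by
  obtain ⟨hdom, hself, hc⟩ := conditions_143 hdL hB₀ hC₁ hC₄ hε₁ hε₄ hB₃ h1 h2 h3 hθ0 hθ
  have hcontr : θ + 4 * B₀ * C₄ * (ε₄ + 2 * dL * B₀ * C₁ * ε₁) < 1 := by linarith
  refine ⟨existsUnique_solution h𝒢 hΛ hW hB₀ hC₄ hθ0 hJ h𝔄 hε₄ hdom hself hcontr, fun X hX hfix => ?_⟩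
  set ε₄' : ℝ := 2 * B₀ * C₁ * B₃ * ε₁ with hε₄'def
  have hB₃0 : 0 ≤ B₃ := hdL.trans hB₃
  have hε₄'0 : 0 ≤ ε₄' := by rw [hε₄'def]; positivity
  have h2' : 4 * ε₄' ≤ a₃ := by linarith
  have h3' : 16 * B₀ * C₄ * ε₄' ≤ 1 :=
    (mul_le_mul_of_nonneg_left h1 (by positivity)).trans h3
  obtain ⟨-, hself', -⟩ := conditions_143 hdL hB₀ hC₁ hC₄ hε₁ hε₄'0 hB₃ le_rfl h2' h3' hθ0 hθ
  exact norm_solution_le h𝒢 hΛ hW hB₀ hC₄ hθ0 hJ h𝔄 hε₄ hdom hself hcontr hε₄'0 h1 hself' hX hfix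

/-! ## §4. Eq. (158) (Sect. F, background 1: J = 0, Δ^{(2)} = 0) -/

/-- **Eq. (158) p. 302** — *«We assume that it belongs to the domain on which this equation has a unique solution,
i.e. we assume that 40dL²B₁Mε₀ ≤ a₄»*: for X ↦ −G̃((δ/δA′)V)(X + HB) with ‖HB‖ < a ≤ ε₄ (printed: a = 4dL²B₁Mε₀ =
ε₄⁄10, ε₄ = 40dL²B₁Mε₀), 4ε₄ ≤ a₃ and 16B₀C₄ε₄ ≤ 1 (Prop. 6's own a₄; C-adv7-12 (c)): the domain condition
2(ε₄ + a) ≤ a₃, the self-map condition B₀C₄(ε₄ + a)² ≤ ε₄ and the contraction constant 4B₀C₄(ε₄ + a) ≤ ½ hold, so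
there is exactly one solution with ‖X‖ ≤ ε₄. [cite: Balaban1985Variational, (158) p.302] -/
theorem eq158_solution [CompleteSpace 𝒴] (h𝒢 : ∀ f, ‖𝒢 f‖ ≤ B₀ * ‖f‖) (hW : QuadAnalytic W C₄ a₃)
    (hB₀ : 0 ≤ B₀) (hC₄ : 0 ≤ C₄) {𝔄 : 𝒴} {a ε₄ : ℝ} (h𝔄 : ‖𝔄‖ < a) (ha : a ≤ ε₄) (hε₄ : 0 ≤ ε₄)
    (h2 : 4 * ε₄ ≤ a₃) (h3 : 16 * B₀ * C₄ * ε₄ ≤ 1) :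
    ∃! X : 𝒴, ‖X‖ ≤ ε₄ ∧ -𝒢 (W (X + 𝔄)) = X := by
  have hΛ : ∀ Y : 𝒴, ‖(0 : 𝒴 →L[ℂ] 𝒴) Y‖ ≤ 0 * ‖Y‖ := fun Y => by simp
  have hJ : ‖(0 : 𝒵)‖ ≤ 0 := by simp
  have hm : ε₄ + a ≤ 2 * ε₄ := by linarith
  have ha0 : 0 < a := (norm_nonneg _).trans_lt h𝔄
  have hm0 : 0 ≤ ε₄ + a := by linarith
  have hdom : 2 * (ε₄ + a) ≤ a₃ := by linarith
  have hself : B₀ * 0 + 0 * (ε₄ + a) + B₀ * C₄ * (ε₄ + a) ^ 2 ≤ ε₄ := by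
    have e1 : (ε₄ + a) ^ 2 ≤ (2 * ε₄) ^ 2 := pow_le_pow_left₀ hm0 hm 2
    have e2 : B₀ * C₄ * (ε₄ + a) ^ 2 ≤ B₀ * C₄ * (2 * ε₄) ^ 2 := mul_le_mul_of_nonneg_left e1 (by positivity)
    have e3 : 16 * B₀ * C₄ * ε₄ * ε₄ ≤ 1 * ε₄ := mul_le_mul_of_nonneg_right h3 hε₄
    nlinarith
  have hcontr : 0 + 4 * B₀ * C₄ * (ε₄ + a) < 1 := by
    have e1 : 4 * B₀ * C₄ * (ε₄ + a) ≤ 4 * B₀ * C₄ * (2 * ε₄) := mul_le_mul_of_nonneg_left hm (by positivity)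
    nlinarith
  have h := existsUnique_solution h𝒢 hΛ hW hB₀ hC₄ le_rfl hJ h𝔄 hε₄ hdom hself hcontr
  simpa only [mapT_158] using h

/-! ## §5. «the solution is an analytic function of 𝔄» (the last clause of Proposition 6; p. 296; (180) p. 306) -/

/-- Proposition 4's two properties of W = (δ/δA′)V in FRÉCHET form (p. 292: *«The functional derivative of V(A′) is
an analytic function on this space, and satisfies the estimate … (98)»*; on the finite lattice T_η «analytic» is
holomorphy on an open subset of a finite-dimensional complex space): the quadratic bound on ‖Y‖ < a₃ and
`DifferentiableOn ℂ` there.  A HYPOTHESIS structure: nothing printed is asserted; it implies B13's line-analytic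
`QuadAnalytic`. [cite: Balaban1985Variational, Prop. 4 (97)-(98) pp.292-293] -/
structure Prop4Hyp (W : 𝒴 → 𝒵) (C₄ a₃ : ℝ) : Prop where
  quad : ∀ Y : 𝒴, ‖Y‖ < a₃ → ‖W Y‖ ≤ C₄ * ‖Y‖ ^ 2
  differentiableOn : DifferentiableOn ℂ W {Y : 𝒴 | ‖Y‖ < a₃}

/-- Fréchet-analytic on the ball ⟹ analytic along complex lines (B13's `QuadAnalytic`). [folklore] -/
theorem Prop4Hyp.quadAnalytic (hW : Prop4Hyp W C₄ a₃) : QuadAnalytic W C₄ a₃ where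
  quad := hW.quad
  lineAnalytic P Q := by
    have hline : Differentiable ℂ (fun ζ : ℂ => P + ζ • Q) :=
      (differentiable_const P).add (differentiable_id.smul_const Q)
    exact hW.differentiableOn.comp hline.differentiableOn (fun ζ hζ => hζ)

/-- **The analyticity clause** (p. 296: *«the analyticity follows from the fact that the solution can be constructed
as a uniform limit of a sequence of successive approximations. The analyticity of these approximations follows from
the analyticity of δ/δA′V(A′) as a function of A′»*), kernel form via `B13Contraction113.differentiableOn_fixedPoint`:
for holomorphic families σ ↦ J_σ, σ ↦ 𝔄_σ on an open V ⊆ ℂ with ‖J_σ‖ ≤ j and ‖𝔄_σ‖ < a there, under the scheme's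
conditions (domain, θ-extended (118), contraction), the unique solution X(σ) in ‖X‖ ≤ ε₄ depends holomorphically
on σ.  Covers Prop. 6's «analytic function of 𝔄» (J constant, 𝔄_σ a complex line) and the analyticity in B of the
solutions of (143) / of the display before (180) p. 306 (J_σ, 𝔄_σ = H₀B_σ linear in the parameter).
[cite: Balaban1985Variational, Prop. 6 p.296, (180) p.306] -/
theorem solution_analytic [CompleteSpace 𝒴] (h𝒢 : ∀ f, ‖𝒢 f‖ ≤ B₀ * ‖f‖) (hΛ : ∀ Y, ‖Λ Y‖ ≤ θ * ‖Y‖)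
    (hW : Prop4Hyp W C₄ a₃) (hB₀ : 0 ≤ B₀) (hC₄ : 0 ≤ C₄) (hθ : 0 ≤ θ) {j a ε₄ : ℝ} (hε₄ : 0 ≤ ε₄)
    (hdom : 2 * (ε₄ + a) ≤ a₃) (hself : B₀ * j + θ * (ε₄ + a) + B₀ * C₄ * (ε₄ + a) ^ 2 ≤ ε₄)
    (hcontr : θ + 4 * B₀ * C₄ * (ε₄ + a) < 1) {V : Set ℂ} (hV : IsOpen V) {Jf : ℂ → 𝒵} {𝔄f : ℂ → 𝒴}
    (hJd : DifferentiableOn ℂ Jf V) (h𝔄d : DifferentiableOn ℂ 𝔄f V) (hJ : ∀ σ ∈ V, ‖Jf σ‖ ≤ j)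
    (h𝔄 : ∀ σ ∈ V, ‖𝔄f σ‖ < a) :
    ∃ Xs : ℂ → 𝒴, DifferentiableOn ℂ Xs V ∧ ∀ σ ∈ V,
      ‖Xs σ‖ ≤ ε₄ ∧ mapT 𝒢 Λ W (Jf σ) (𝔄f σ) (Xs σ) = Xs σ ∧
      ∀ X' : 𝒴, ‖X'‖ ≤ ε₄ → mapT 𝒢 Λ W (Jf σ) (𝔄f σ) X' = X' → X' = Xs σ := by
  by_cases hVne : V.Nonempty
  swap
  · refine ⟨fun _ => 0, ?_, fun σ hσ => (hVne ⟨σ, hσ⟩).elim⟩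
    rw [Set.not_nonempty_iff_eq_empty.mp hVne]; exact differentiableOn_empty
  obtain ⟨σ₀, hσ₀⟩ := hVne
  have ha : 0 < a := (norm_nonneg _).trans_lt (h𝔄 σ₀ hσ₀)
  have hdom1 : ε₄ + a ≤ a₃ := by linarith
  have hq0 : 0 ≤ θ + 4 * B₀ * C₄ * (ε₄ + a) := by positivity
  have hWq : QuadAnalytic W C₄ a₃ := hW.quadAnalytic
  have hmaps : ∀ σ ∈ V, MapsTo (fun X => mapT 𝒢 Λ W (Jf σ) (𝔄f σ) X) (closedBall (0:𝒴) ε₄)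
      (closedBall (0:𝒴) ε₄) := by
    intro σ hσ X hX
    rw [mem_closedBall_zero_iff] at hX ⊢
    exact mapsTo_118 h𝒢 hΛ hWq hB₀ hC₄ hθ (hJ σ hσ) (h𝔄 σ hσ) hdom1 hself X hX
  have hlip : ∀ σ ∈ V, ∀ X ∈ closedBall (0:𝒴) ε₄, ∀ X' ∈ closedBall (0:𝒴) ε₄,
      ‖mapT 𝒢 Λ W (Jf σ) (𝔄f σ) X - mapT 𝒢 Λ W (Jf σ) (𝔄f σ) X'‖ ≤
        (θ + 4 * B₀ * C₄ * (ε₄ + a)) * ‖X - X'‖ := by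
    intro σ hσ X hX X' hX'
    rw [mem_closedBall_zero_iff] at hX hX'
    exact lipschitz_120 (J := Jf σ) h𝒢 hΛ hWq hB₀ hC₄ (h𝔄 σ hσ) hε₄ hdom hX hX'
  have han : ∀ g : ℂ → 𝒴, DifferentiableOn ℂ g V → MapsTo g V (closedBall (0:𝒴) ε₄) →
      DifferentiableOn ℂ (fun σ => mapT 𝒢 Λ W (Jf σ) (𝔄f σ) (g σ)) V := by
    intro g hg hgm
    have hinner : DifferentiableOn ℂ (fun σ => g σ + 𝔄f σ) V := hg.add h𝔄d
    have hinto : MapsTo (fun σ => g σ + 𝔄f σ) V {Y : 𝒴 | ‖Y‖ < a₃} := by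
      intro σ hσ
      have hgσ : ‖g σ‖ ≤ ε₄ := mem_closedBall_zero_iff.1 (hgm hσ)
      have hlt : ‖g σ + 𝔄f σ‖ < ε₄ + a := norm_arg_lt (h𝔄 σ hσ) hgσ
      exact hlt.trans_le hdom1
    have tW : DifferentiableOn ℂ (fun σ => W (g σ + 𝔄f σ)) V :=
      hW.differentiableOn.comp hinner hinto
    have t1 : DifferentiableOn ℂ (fun σ => 𝒢 (Jf σ)) V := 𝒢.differentiable.comp_differentiableOn hJd
    have t2 : DifferentiableOn ℂ (fun σ => Λ (g σ + 𝔄f σ)) V :=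
      Λ.differentiable.comp_differentiableOn hinner
    have t3 : DifferentiableOn ℂ (fun σ => 𝒢 (W (g σ + 𝔄f σ))) V :=
      𝒢.differentiable.comp_differentiableOn tW
    show DifferentiableOn ℂ (fun σ => -𝒢 (Jf σ) + Λ (g σ + 𝔄f σ) - 𝒢 (W (g σ + 𝔄f σ))) V
    exact (t1.neg.add t2).sub t3
  obtain ⟨Xs, hXd, hfix, -⟩ := differentiableOn_fixedPoint
    (T := fun σ X => mapT 𝒢 Λ W (Jf σ) (𝔄f σ) X) hV hε₄ hq0 hcontr hmaps hlip han
  refine ⟨Xs, hXd, fun σ hσ => ?_⟩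
  have hXn : ‖Xs σ‖ ≤ ε₄ := mem_closedBall_zero_iff.1 (hfix σ hσ).1
  refine ⟨hXn, (hfix σ hσ).2, fun X' hX' hfix' => ?_⟩
  obtain ⟨X₀, -, huniq⟩ := existsUnique_solution h𝒢 hΛ hWq hB₀ hC₄ hθ (hJ σ hσ) (h𝔄 σ hσ) hε₄ hdom
    hself hcontr
  rw [huniq X' ⟨hX', hfix'⟩, huniq (Xs σ) ⟨hXn, (hfix σ hσ).2⟩]

/-- **«the solution is an analytic function of 𝔄»** along every complex line 𝔄₀ + σ𝔄₁ inside the region ‖𝔄‖ < a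
(J fixed with ‖J‖ ≤ j): the unique solution in ‖X‖ ≤ ε₄ is a holomorphic function of σ on the open set
{σ : ‖𝔄₀ + σ𝔄₁‖ < a}. [cite: Balaban1985Variational, Prop. 6 pp.295-296] -/
theorem solution_analytic_line [CompleteSpace 𝒴] (h𝒢 : ∀ f, ‖𝒢 f‖ ≤ B₀ * ‖f‖)
    (hΛ : ∀ Y, ‖Λ Y‖ ≤ θ * ‖Y‖) (hW : Prop4Hyp W C₄ a₃) (hB₀ : 0 ≤ B₀) (hC₄ : 0 ≤ C₄) (hθ : 0 ≤ θ)
    {J : 𝒵} {j a ε₄ : ℝ} (hJ : ‖J‖ ≤ j) (hε₄ : 0 ≤ ε₄) (hdom : 2 * (ε₄ + a) ≤ a₃)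
    (hself : B₀ * j + θ * (ε₄ + a) + B₀ * C₄ * (ε₄ + a) ^ 2 ≤ ε₄)
    (hcontr : θ + 4 * B₀ * C₄ * (ε₄ + a) < 1) (𝔄₀ 𝔄₁ : 𝒴) :
    ∃ Xs : ℂ → 𝒴, DifferentiableOn ℂ Xs {σ : ℂ | ‖𝔄₀ + σ • 𝔄₁‖ < a} ∧
      ∀ σ : ℂ, ‖𝔄₀ + σ • 𝔄₁‖ < a →
        ‖Xs σ‖ ≤ ε₄ ∧ mapT 𝒢 Λ W J (𝔄₀ + σ • 𝔄₁) (Xs σ) = Xs σ ∧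
        ∀ X' : 𝒴, ‖X'‖ ≤ ε₄ → mapT 𝒢 Λ W J (𝔄₀ + σ • 𝔄₁) X' = X' → X' = Xs σ := by
  have hV : IsOpen {σ : ℂ | ‖𝔄₀ + σ • 𝔄₁‖ < a} :=
    isOpen_lt (continuous_const.add (continuous_id.smul continuous_const)).norm continuous_const
  have h𝔄d : DifferentiableOn ℂ (fun σ : ℂ => 𝔄₀ + σ • 𝔄₁) {σ : ℂ | ‖𝔄₀ + σ • 𝔄₁‖ < a} :=
    ((differentiable_const 𝔄₀).add (differentiable_id.smul_const 𝔄₁)).differentiableOn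
  obtain ⟨Xs, hXd, hXs⟩ := solution_analytic h𝒢 hΛ hW hB₀ hC₄ hθ hε₄ hdom hself hcontr hV
    (differentiableOn_const J) h𝔄d (fun σ _ => hJ) (fun σ hσ => hσ)
  exact ⟨Xs, hXd, fun σ hσ => hXs σ hσ⟩

end Literature.MathematicalPhysics.QuantumFieldTheory.Balaban1983to89.B11Prop6Scheme
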